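import Summits.MatrixMultiplication.OmegaCensus.STPPVosperTightStructure
import Summits.MatrixMultiplication.OmegaCensus.STPPVosperClash61Tools2
import Summits.MatrixMultiplication.OmegaCensus.STPP222SqSymmetry

/-!
# ω-census (abelian STPP census): a DOUBLE Vosper clash at `ℤ₆₁` — the three-block beating pattern {(2,2,2),(2,3,4),(2,3,5)} has no STPP family in ℤ₆₁ (kernel)

HONEST FRAMING (pub-omega census; verbatim): lottery ticket; floor = certified bounds/negative ranges.
Census STRUCTURE (seat pub-omega-stpp-1 gen 29, 2026-08-28), family (b2).  Fourth file of the ℤ₆₁ Vosper series; with `STPPVosperClash235244`, `…325244` and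
`…225332342` it EXCLUDES the last of the doubly-N18-tight beating candidates at the prime order `61` listed in HOME `pub-omega-stpp-1-g28/CLOSEOUT.md`
(`Σ aᵢbᵢcᵢ = 8 + 24 + 30 = 62 > 61`); nothing here is progress on `ω`.

## Statement and proof

`no_isSTPP_zmod61_222_234_235`: there is no STPP family (CKSU 2005 Def. 5.1, the tree's `IsSTPP`) `(Aᵢ,Bᵢ,Cᵢ)_{i<3}` in `ℤ/61ℤ` with
`(|Aᵢ|,|Bᵢ|,|Cᵢ|) = (2,2,2), (2,3,4), (2,3,5)`.

The pattern is N18-tight at block `(2,3,5)` in TWO role readings, and one reading alone does NOT suffice: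

* Reading `(a,b,c)` (`vosper47_structure` applied to `(A,B,C)`): `|Z°| + b₃ + vol + a₃ + |Y°| = 12 + 3 + 30 + 2 + 16 = 63`; Vosper gives `A₃ = {α, α+e}`,
  `B₃` a 3-progression of step `e′`, `Y° − A₃` a 17-progression of step `e` and `W ⊔ (Y° − A₃)` a 47-progression of step `e′` (`W = C₃ − A₃ − B₃` = ten
  disjoint 3-progressions of step `e′`).  After transport the prefix law for 3-runs and the table `step3_nat_47_17_r3` leave `e/e′ ∈ {±1, ±20}`
  (`ratio_val_mem`) — the ratio `±20` IS realised by a window configuration (`S = {0..5} ∪ {21..25} ∪ {41..46}`, complement two 15-runs).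
* Reading `(a,c,b)` (the family `(−A, −C, −B)`, `STPP222SqNeg.isSTPP_negSwap` of `STPP222SqSymmetry.lean`): `10 + 5 + 30 + 2 + 16 = 63`; now `−C₃` is a 5-progression of step `f′`,
  the same `Y°` appears (`(−B) − (−C) = C − B`), `−A₃ = {α′, α′ + f}` with `f = ±e`, and the table `step3_nat_47_17_r5` leaves `f/f′ ∈ {±1, ±20}`.
* Clash: `e = ±e′` breaks the TPP of block 3 through `A₃, B₃` (word `(s′−s)+(t′−t)+(u−u) = 0`); `e = ±f′` breaks it through `A₃, C₃`; and
  `e = ±20e′`, `f = ±20f′`, `f = ±e` give `e′² = f′²`, i.e. `e′ = ±f′`, which breaks it through `B₃, C₃`.  (Signs are handled through squares: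
  `e² = 34·e′²` etc., `20² ≡ 41² ≡ 34`, `9·34 ≡ 1 (mod 61)`.)

Tools: `STPPVosperTightStructure` (p585894/p597752), `STPPVosperClash61Tools{,2}`.  Paper version: HOME `pub-omega-stpp-1-g29/VOSPER-CLASH-222-234-235-Z61.md`.

References: A. G. Vosper, J. London Math. Soc. 31 (1956); M. B. Nathanson, *Additive Number Theory: Inverse Problems*, GTM 165, Thm 2.7; H. Cohn,
R. Kleinberg, B. Szegedy, C. Umans, FOCS 2005 (arXiv:math/0511460), Def. 5.1.
-/

open Finset
open scoped Pointwise

namespace Summit.MatrixMultiplication.OmegaCensus.CubeNB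

open Literature.Computability.AlgebraicComplexity
open Literature.Combinatorics.Additive
open Summit.MatrixMultiplication.OmegaCensus.STPPKneser

/-- **Step 0 + counting (both readings).**  A three-block STPP family in `ℤ₆₁` with non-empty sets, `|A₃| = 2`, `|B₃| ≥ 2`, `vol₃ = 30`,
`|Z°| + |B₃| = 15`, `|Z°| ≥ 2`, `|Y°| = 16` (so the N18 chain is tight at block 3): nonzero `e, e′` and `α, β, y₀, v` with `A₃ = {α, α+e}`, `B₃ = {β + i•e′}`,
and the block-3 sumset `W` disjoint from the 17-progression `{y₀ − α − e + i•e : i < 17} = Y° − A₃` with union the 47-progression `{v + i•e′ : i < 47}`.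
[cite: CohnKleinbergSzegedyUmans2005, Def. 5.1] [cite: Nathanson1996, Thm 2.7] -/
theorem vosper47_structure (A B C : Fin 3 → Finset (ZMod 61)) (hS : IsSTPP A B C)
    (hAne : ∀ i, (A i).Nonempty) (hBne : ∀ i, (B i).Nonempty) (hCne : ∀ i, (C i).Nonempty)
    (hA2 : #(A 2) = 2) (h2B : 2 ≤ #(B 2)) (hvol : #(A 2) * #(B 2) * #(C 2) = 30) {z : ℕ}
    (hZ : ∑ k ∈ univ.erase 2, #(A k) * #(C k) = z) (hzb : z + #(B 2) = 15) (h2z : 2 ≤ z)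
    (hY : ∑ k ∈ univ.erase 2, #(B k) * #(C k) = 16) :
    ∃ e e' α β y₀ v : ZMod 61, e ≠ 0 ∧ e' ≠ 0 ∧ A 2 = apFinset α e 2 ∧ B 2 = apFinset β e' #(B 2) ∧
      Disjoint (((A 2) ×ˢ ((B 2) ×ˢ (C 2))).image fun q : ZMod 61 × ZMod 61 × ZMod 61 => (0 : ZMod 61) + q.2.2 - q.1 - q.2.1)
        (apFinset (0 - α - 1 • e + y₀) e 17) ∧
      (((A 2) ×ˢ ((B 2) ×ˢ (C 2))).image fun q : ZMod 61 × ZMod 61 × ZMod 61 => (0 : ZMod 61) + q.2.2 - q.1 - q.2.1) ∪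
        apFinset (0 - α - 1 • e + y₀) e 17 = apFinset v e' 47 := by
  haveI : Fact (Nat.Prime 61) := ⟨prime_61⟩
  have hI2 : ((univ : Finset (Fin 3)).erase 2).Nonempty := ⟨0, by decide⟩
  obtain ⟨⟨e, he, hAap, hYap⟩, ⟨e', he', hBap, -, hVap, -, hEq⟩⟩ := vosper_structure_of_n18_tight_V hS hAne hBne hCne 2 hI2
    (by rw [hA2]) h2B (by rw [hY]; omega) (by rw [hZ]; exact h2z) (by rw [hZ, hY, hvol, hA2]; omega)
  -- names
  set W := ((A 2) ×ˢ ((B 2) ×ˢ (C 2))).image fun q : ZMod 61 × ZMod 61 × ZMod 61 => (0 : ZMod 61) + q.2.2 - q.1 - q.2.1 with hW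
  set Sn := (A 2).image (fun a => (0 : ZMod 61) - a) with hSn
  set Yo := DU B C (univ.erase 2) with hYo
  have hWcard : #W = 30 := by rw [hW, card_image_blockSum hS 2 0, hvol]
  have hWV : Disjoint W (Sn + Yo) := disjoint_W_negA_add_DU hS 2
  have hYocard : #Yo = 16 := by rw [hYo, card_DU_BC hS hAne, hY]
  -- the progressions
  obtain ⟨α, hα⟩ := hAap
  obtain ⟨β, hβ⟩ := hBap
  obtain ⟨y₀, hy⟩ := hYap
  obtain ⟨v, hv⟩ := hVap
  rw [hA2] at hα; rw [hYocard] at hy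
  -- Sn + Yo lies in a 17-progression of step e
  have hSn2 : Sn = apFinset (0 - α - 1 • e) e 2 := by rw [hSn, hα, image_sub_apFinset]
  have hsub17 : Sn + Yo ⊆ apFinset (0 - α - 1 • e + y₀) e 17 := by
    rw [hSn2, hy]; exact apFinset_add_apFinset_subset _ _ _ 2 16
  have hle17 : #(Sn + Yo) ≤ 17 := (Finset.card_le_card hsub17).trans (card_apFinset_le _ _ _)
  -- |V| ≥ 47 from B₃ + V = H ∖ Z° (61 − z elements)
  have hZcard : #(DU A C (univ.erase 2)) = z := by rw [card_DU_AC hS hBne, hZ]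
  have hU : #(univ \ DU A C ((univ : Finset (Fin 3)).erase 2)) = 61 - z := by
    rw [Finset.card_sdiff_of_subset (Finset.subset_univ _), Finset.card_univ, ZMod.card, hZcard]
  have hBV : #(B 2 + (W ∪ (Sn + Yo))) ≤ #(B 2) + #(W ∪ (Sn + Yo)) - 1 := by
    have h := (Finset.card_le_card (apFinset_add_apFinset_subset β v e' #(B 2) #(W ∪ (Sn + Yo)))).trans
      (card_apFinset_le _ _ _)
    rwa [← hβ, ← hv] at h
  rw [hEq, hU] at hBV
  have hVcard : #(W ∪ (Sn + Yo)) = #W + #(Sn + Yo) := Finset.card_union_of_disjoint hWV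
  have h17 : #(Sn + Yo) = 17 := by omega
  have hV47 : #(W ∪ (Sn + Yo)) = 47 := by omega
  have hSY : Sn + Yo = apFinset (0 - α - 1 • e + y₀) e 17 :=
    Finset.eq_of_subset_of_card_le hsub17 (by rw [h17, card_apFinset he (by norm_num)])
  rw [hV47] at hv
  refine ⟨e, e', α, β, y₀, v, he, he', hα, hβ, ?_, ?_⟩
  · rw [← hSY]; exact hWV
  · rw [← hSY]; exact hv

/-- **Steps 1–3 (one reading): the ratio `e/e′` lies in the table's target set.**  In the situation of `vosper47_structure` with `B₃` a `b`-progression of step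
`e′` (`1 ≤ b ≤ 15`): `W = ⋃_{(a,c) ∈ A₃×C₃} (c − a − B₃)` is a disjoint union of `b`-progressions (TPP of block 3); after the transport `x ↦ e′⁻¹(x − v)` the
prefix law `dvd_card_filter_val_lt` holds at the seventeen points of the image of `Y° − A₃`, and the `ℕ`-table for `(47, 17, b)` with target `J` gives
`(e′⁻¹·e).val ∈ J` (`val_mem_of_nat_table`). [cite: CohnKleinbergSzegedyUmans2005, Def. 5.1] [cite: Nathanson1996, §2.5] -/
theorem ratio_val_mem (A B C : Fin 3 → Finset (ZMod 61)) (hS : IsSTPP A B C) {b : ℕ} (hb1 : 1 ≤ b) (hb15 : b ≤ 15)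
    {e e' α β y₀ v : ZMod 61} (he : e ≠ 0) (he' : e' ≠ 0) (hβ : B 2 = apFinset β e' b)
    (hdisj : Disjoint (((A 2) ×ˢ ((B 2) ×ˢ (C 2))).image fun q : ZMod 61 × ZMod 61 × ZMod 61 => (0 : ZMod 61) + q.2.2 - q.1 - q.2.1)
      (apFinset (0 - α - 1 • e + y₀) e 17))
    (hunion : (((A 2) ×ˢ ((B 2) ×ˢ (C 2))).image fun q : ZMod 61 × ZMod 61 × ZMod 61 => (0 : ZMod 61) + q.2.2 - q.1 - q.2.1) ∪
      apFinset (0 - α - 1 • e + y₀) e 17 = apFinset v e' 47)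
    {J : Finset ℕ} (htable : ∀ j < 61, ∀ t < 61, (∀ i < 17, (t + j * i) % 61 < 47) →
      (∀ k < 17, b ∣ (t + j * k) % 61 - #((range 17).filter fun i => (t + j * i) % 61 < (t + j * k) % 61)) → j ∈ J) :
    (e'⁻¹ * e).val ∈ J := by
  haveI : Fact (Nat.Prime 61) := ⟨prime_61⟩
  obtain ⟨b', rfl⟩ : ∃ b', b = b' + 1 := ⟨b - 1, by omega⟩
  set W := ((A 2) ×ˢ ((B 2) ×ˢ (C 2))).image fun q : ZMod 61 × ZMod 61 × ZMod 61 => (0 : ZMod 61) + q.2.2 - q.1 - q.2.1 with hW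
  -- Step 1: W is the union of the blocks (c − a) − B₃, pairwise disjoint by the TPP of block 3
  set P := (A 2) ×ˢ (C 2) with hP
  have hblk : ∀ ac : ZMod 61 × ZMod 61,
      (B 2).image (fun y => (ac.2 - ac.1) - y) = apFinset (ac.2 - ac.1 - β - b' • e') e' (b' + 1) := by
    intro ac; rw [hβ, image_sub_apFinset]
  have hWeq : W = P.biUnion fun ac => apFinset (ac.2 - ac.1 - β - b' • e') e' (b' + 1) := by
    ext x
    simp only [hW, hP, Finset.mem_image, Finset.mem_product, Finset.mem_biUnion, Prod.exists]
    constructor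
    · rintro ⟨a, y, c, ⟨ha, hy, hc⟩, rfl⟩
      refine ⟨a, c, ⟨ha, hc⟩, ?_⟩
      rw [← hblk (a, c)]
      exact Finset.mem_image.2 ⟨y, hy, by abel⟩
    · rintro ⟨a, c, ⟨ha, hc⟩, hx⟩
      rw [← hblk (a, c)] at hx
      obtain ⟨y, hy, rfl⟩ := Finset.mem_image.1 hx
      exact ⟨a, y, c, ⟨ha, hy, hc⟩, by abel⟩
  have hPdisj : (P : Set (ZMod 61 × ZMod 61)).PairwiseDisjoint fun ac => apFinset (ac.2 - ac.1 - β - b' • e') e' (b' + 1) := by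
    rintro ⟨a, c⟩ hac ⟨a', c'⟩ hac' hne
    rw [Function.onFun, ← hblk, ← hblk, Finset.disjoint_left]
    intro x hx hx'
    obtain ⟨y, hy, rfl⟩ := Finset.mem_image.1 hx
    obtain ⟨y', hy', hyy⟩ := Finset.mem_image.1 hx'
    have hac2 := Finset.mem_product.1 (Finset.mem_coe.1 hac)
    have hac2' := Finset.mem_product.1 (Finset.mem_coe.1 hac')
    -- word at (3,3,3): (a′ − a) + (y′ − y) + (c − c′) = 0
    have hrel : (a' - a) + (y' - y) + (c - c') = 0 := by
      have h : c' - a' - y' = c - a - y := hyy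
      linear_combination (-1 : ZMod 61) * h
    obtain ⟨-, -, h3, -, h5⟩ := hS 2 2 2 a hac2.1 a' hac2'.1 y hy y' hy' c' hac2'.2 c hac2.2 hrel
    exact hne (Prod.ext h3 h5.symm)
  -- Step 2: transport by φ(x) = u·x + w, u = e′⁻¹, w = −u·v
  obtain ⟨u, hu⟩ : ∃ u : ZMod 61, u = e'⁻¹ := ⟨_, rfl⟩
  have hu0 : u ≠ 0 := by rw [hu]; exact inv_ne_zero he'
  have hue : u * e' = 1 := by rw [hu]; exact inv_mul_cancel₀ he'
  obtain ⟨w, hw⟩ : ∃ w : ZMod 61, w = -(u * v) := ⟨_, rfl⟩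
  have hφinj : Function.Injective (fun x : ZMod 61 => u * x + w) := affine_injective hu0 w
  have hφV : (apFinset v e' 47).image (fun x => u * x + w) = apFinset 0 1 47 := by
    rw [image_affine_apFinset, hue, hw, add_neg_cancel]
  set g : ZMod 61 × ZMod 61 → ZMod 61 := fun ac => u * (ac.2 - ac.1 - β - b' • e') + w with hg
  have hφblk : ∀ ac : ZMod 61 × ZMod 61,
      (apFinset (ac.2 - ac.1 - β - b' • e') e' (b' + 1)).image (fun x => u * x + w) = apFinset (g ac) 1 (b' + 1) := by
    intro ac; rw [image_affine_apFinset, hue]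
  set T := W.image (fun x => u * x + w) with hT
  have hTeq : T = P.biUnion fun ac => apFinset (g ac) 1 (b' + 1) := by
    rw [hT, hWeq, Finset.biUnion_image]
    exact Finset.biUnion_congr rfl fun ac _ => hφblk ac
  have hTdisj : (P : Set (ZMod 61 × ZMod 61)).PairwiseDisjoint fun ac => apFinset (g ac) 1 (b' + 1) := by
    intro ac hac ac' hac' hne
    rw [Function.onFun, ← hφblk, ← hφblk]
    exact (Finset.disjoint_image hφinj).2 (hPdisj hac hac' hne)
  set S := (apFinset (0 - α - 1 • e + y₀) e 17).image (fun x => u * x + w) with hSdef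
  have hSeq : S = apFinset (u * (0 - α - 1 • e + y₀) + w) (u * e) 17 := by rw [hSdef, image_affine_apFinset]
  have hTS : T ∪ S = apFinset 0 1 47 := by rw [hT, hSdef, ← Finset.image_union, hunion, hφV]
  have hTSdisj : Disjoint T S := by rw [hT, hSdef]; exact (Finset.disjoint_image hφinj).2 hdisj
  have hTsub : ∀ ac ∈ P, apFinset (g ac) 1 (b' + 1) ⊆ apFinset 0 1 47 := by
    intro ac hac y hy
    rw [← hTS, hTeq]
    exact Finset.mem_union_left _ (Finset.mem_biUnion.2 ⟨ac, hac, hy⟩)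
  have hSsub : S ⊆ apFinset 0 1 47 := by rw [← hTS]; exact Finset.subset_union_right
  -- Step 3: the prefix law at the points of S, and the table
  have hj0 : u * e ≠ 0 := mul_ne_zero hu0 he
  have hgap : ∀ x ∈ S, (b' + 1) ∣ x.val - #(S.filter fun y => y.val < x.val) := by
    intro x hxS
    have hxT : x ∉ T := fun hxT => Finset.disjoint_left.1 hTSdisj hxT hxS
    have hxle : x.val ≤ 47 := ((mem_apFinset_zero_one_iff (p := 61) (by norm_num)).1 (hSsub hxS)).le
    have h4 : (b' + 1) ∣ #(T.filter fun y => y.val < x.val) := by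
      rw [hTeq]
      exact dvd_card_filter_val_lt P g (by omega) hTdisj hTsub x (by rw [← hTeq]; exact hxT)
    rw [(card_filter_val_lt_of_union_window (by norm_num) hTS hTSdisj hxle).2] at h4
    exact h4
  rw [hSeq] at hgap hSsub
  have hval := val_mem_of_nat_table (by norm_num) (by norm_num) htable hj0 hSsub hgap
  rwa [hu] at hval

/-- **DOUBLE VOSPER CLASH (kernel): the three-block beating pattern `{(2,2,2),(2,3,4),(2,3,5)}` (`Σ abc = 62 > 61`) is realised by NO STPP family in
`ℤ₆₁`.**  See the module docstring: the readings `(a,b,c)` and `(a,c,b)` are both N18-tight at block `(2,3,5)`; each gives `ratio ∈ {±1, ±20}` for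
`e/e′` resp. `f/f′` (`B₃` a 3-progression of step `e′`, `C₃` a 5-progression of step `f′`, `A₃ = {α, α+e}`, `f = ±e`), and every combination breaks the
TPP of block 3 through one of the pairs `(A₃,B₃)`, `(A₃,C₃)`, `(B₃,C₃)`.  HOME `pub-omega-stpp-1-g29/VOSPER-CLASH-222-234-235-Z61.md` (paper).
[cite: CohnKleinbergSzegedyUmans2005, Def. 5.1] [cite: Nathanson1996, Thm 2.7] -/
theorem no_isSTPP_zmod61_222_234_235 (A B C : Fin 3 → Finset (ZMod 61)) (hS : IsSTPP A B C)
    (hA : ∀ i, #(A i) = ![2, 2, 2] i) (hB : ∀ i, #(B i) = ![2, 3, 3] i) (hC : ∀ i, #(C i) = ![2, 4, 5] i) : False := by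
  have h61 : (61 : ZMod 61) = 0 := by decide
  have h20 : ((20 : ℕ) : ZMod 61) = 20 := by norm_num
  have h41 : ((41 : ℕ) : ZMod 61) = 41 := by norm_num
  have h60 : ((60 : ℕ) : ZMod 61) = -1 := by decide
  haveI : Fact (Nat.Prime 61) := ⟨prime_61⟩
  have hAne : ∀ i, (A i).Nonempty := fun i => card_pos.1 (by rw [hA]; fin_cases i <;> simp)
  have hBne : ∀ i, (B i).Nonempty := fun i => card_pos.1 (by rw [hB]; fin_cases i <;> simp)
  have hCne : ∀ i, (C i).Nonempty := fun i => card_pos.1 (by rw [hC]; fin_cases i <;> simp)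
  have e2 : (univ : Finset (Fin 3)).erase 2 = {0, 1} := by decide
  -- Reading (a,b,c)
  have sAC : ∑ k ∈ (univ : Finset (Fin 3)).erase 2, #(A k) * #(C k) = 12 := by
    rw [e2, Finset.sum_pair (by decide)]; simp [hA, hC]
  have sBC : ∑ k ∈ (univ : Finset (Fin 3)).erase 2, #(B k) * #(C k) = 16 := by
    rw [e2, Finset.sum_pair (by decide)]; simp [hB, hC]
  have hA2 : #(A 2) = 2 := by rw [hA]; simp
  have hB2 : #(B 2) = 3 := by rw [hB]; simp
  have hC2 : #(C 2) = 5 := by rw [hC]; simp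
  obtain ⟨e, e', α, β, y₀, v, he, he', hα, hβ, hdisj, hunion⟩ := vosper47_structure A B C hS hAne hBne hCne hA2
    (by rw [hB2]; omega) (by rw [hA2, hB2, hC2]) sAC (by rw [hB2]) (by norm_num) sBC
  rw [hB2] at hβ
  have hr1 := ratio_val_mem A B C hS (b := 3) (by norm_num) (by norm_num) he he' hβ hdisj hunion step3_nat_47_17_r3
  -- Reading (a,c,b): the family (−A, −C, −B)
  set A' : Fin 3 → Finset (ZMod 61) := fun i => (A i).image Neg.neg with hA'
  set B' : Fin 3 → Finset (ZMod 61) := fun i => (C i).image Neg.neg with hB'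
  set C' : Fin 3 → Finset (ZMod 61) := fun i => (B i).image Neg.neg with hC'
  have hS' : IsSTPP A' B' C' := STPP222SqNeg.isSTPP_negSwap hS
  have hcA' : ∀ i, #(A' i) = #(A i) := fun i => Finset.card_image_of_injective _ neg_injective
  have hcB' : ∀ i, #(B' i) = #(C i) := fun i => Finset.card_image_of_injective _ neg_injective
  have hcC' : ∀ i, #(C' i) = #(B i) := fun i => Finset.card_image_of_injective _ neg_injective
  have hAne' : ∀ i, (A' i).Nonempty := fun i => (hAne i).image _
  have hBne' : ∀ i, (B' i).Nonempty := fun i => (hCne i).image _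
  have hCne' : ∀ i, (C' i).Nonempty := fun i => (hBne i).image _
  have sAC' : ∑ k ∈ (univ : Finset (Fin 3)).erase 2, #(A' k) * #(C' k) = 10 := by
    rw [e2, Finset.sum_pair (by decide)]; simp [hcA', hcC', hA, hB]
  have sBC' : ∑ k ∈ (univ : Finset (Fin 3)).erase 2, #(B' k) * #(C' k) = 16 := by
    rw [e2, Finset.sum_pair (by decide)]; simp [hcB', hcC', hB, hC]
  have hA2' : #(A' 2) = 2 := by rw [hcA', hA2]
  have hB2' : #(B' 2) = 5 := by rw [hcB', hC2]
  have hC2' : #(C' 2) = 3 := by rw [hcC', hB2]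
  obtain ⟨f, f', α', β', y₀', v', hf, hf', hα', hβ', hdisj', hunion'⟩ := vosper47_structure A' B' C' hS' hAne' hBne' hCne' hA2'
    (by rw [hB2']; omega) (by rw [hA2', hB2', hC2']) sAC' (by rw [hB2']) (by norm_num) sBC'
  rw [hB2'] at hβ'
  have hr2 := ratio_val_mem A' B' C' hS' (b := 5) (by norm_num) (by norm_num) hf hf' hβ' hdisj' hunion' step3_nat_47_17_r5
  -- f = ±e (both are steps of the 2-set A₃ up to sign)
  have hfe : f = e ∨ f = -e := by
    have hneg : A' 2 = -(A 2) := rfl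
    rw [hα, neg_apFinset, hα'] at hneg
    rcases step_eq_or_eq_neg_of_apFinset_two_eq he hneg with h | h
    · left; exact h.symm
    · right; linear_combination h
  -- elements
  have hαmem : α ∈ A 2 := by rw [hα]; exact mem_apFinset.2 ⟨0, by norm_num, by simp⟩
  have hαe : α + e ∈ A 2 := by rw [hα]; exact mem_apFinset.2 ⟨1, by norm_num, by simp⟩
  have hβmem : β ∈ B 2 := by rw [hβ]; exact mem_apFinset.2 ⟨0, by norm_num, by simp⟩
  have hβe : β + e' ∈ B 2 := by rw [hβ]; exact mem_apFinset.2 ⟨1, by norm_num, by simp⟩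
  have hγmem : -β' ∈ C 2 := by
    have h : β' ∈ B' 2 := by rw [hβ']; exact mem_apFinset.2 ⟨0, by norm_num, by simp⟩
    obtain ⟨c, hc, hcβ⟩ := Finset.mem_image.1 h
    have : c = -β' := by rw [← hcβ, neg_neg]
    exact this ▸ hc
  have hγf : -β' - f' ∈ C 2 := by
    have h : β' + f' ∈ B' 2 := by rw [hβ']; exact mem_apFinset.2 ⟨1, by norm_num, by simp⟩
    obtain ⟨c, hc, hcβ⟩ := Finset.mem_image.1 h
    have : c = -β' - f' := by rw [show -β' - f' = -(β' + f') by ring, ← hcβ, neg_neg]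
    exact this ▸ hc
  -- the three clash words of block 3
  have hAB : ¬ (e = e' ∨ e = -e') := by
    rintro (h | h)
    · have hrel : (α - (α + e)) + ((β + e') - β) + ((-β') - (-β')) = 0 := by rw [h]; ring
      obtain ⟨-, -, -, h4, -⟩ := hS 2 2 2 (α + e) hαe α hαmem β hβmem (β + e') hβe (-β') hγmem (-β') hγmem hrel
      exact he' (by linear_combination h4.symm)
    · have hrel : ((α + e) - α) + ((β + e') - β) + ((-β') - (-β')) = 0 := by rw [h]; ring
      obtain ⟨-, -, -, h4, -⟩ := hS 2 2 2 α hαmem (α + e) hαe β hβmem (β + e') hβe (-β') hγmem (-β') hγmem hrel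
      exact he' (by linear_combination h4.symm)
  have hAC : ¬ (e = f' ∨ e = -f') := by
    rintro (h | h)
    · -- s′ = α + e, s = α, t = t′ = β, u′ = −β′ − f′, u = −β′
      have hrel : ((α + e) - α) + (β - β) + ((-β' - f') - (-β')) = 0 := by rw [h]; ring
      obtain ⟨-, -, h3, -, -⟩ := hS 2 2 2 α hαmem (α + e) hαe β hβmem β hβmem (-β') hγmem (-β' - f') hγf hrel
      exact he (by linear_combination h3.symm)
    · have hrel : ((α + e) - α) + (β - β) + ((-β') - (-β' - f')) = 0 := by rw [h]; ring
      obtain ⟨-, -, h3, -, -⟩ := hS 2 2 2 α hαmem (α + e) hαe β hβmem β hβmem (-β' - f') hγf (-β') hγmem hrel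
      exact he (by linear_combination h3.symm)
  have hBC : ¬ (e' = f' ∨ e' = -f') := by
    rintro (h | h)
    · have hrel : (α - α) + ((β + e') - β) + ((-β' - f') - (-β')) = 0 := by rw [h]; ring
      obtain ⟨-, -, -, h4, -⟩ := hS 2 2 2 α hαmem α hαmem β hβmem (β + e') hβe (-β') hγmem (-β' - f') hγf hrel
      exact he' (by linear_combination h4.symm)
    · have hrel : (α - α) + ((β + e') - β) + ((-β') - (-β' - f')) = 0 := by rw [h]; ring
      obtain ⟨-, -, -, h4, -⟩ := hS 2 2 2 α hαmem α hαmem β hβmem (β + e') hβe (-β' - f') hγf (-β') hγmem hrel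
      exact he' (by linear_combination h4.symm)
  -- turning the ratio values into equations (signs through squares)
  have key : ∀ {x x' : ZMod 61}, x' ≠ 0 → ∀ c : ℕ, (x'⁻¹ * x).val = c → x = ((c : ℕ) : ZMod 61) * x' := by
    intro x x' hx' c hc
    have hxx : x' * (x'⁻¹ * x) = x := by rw [← mul_assoc, mul_inv_cancel₀ hx', one_mul]
    rw [← hxx, ← hc, ZMod.natCast_zmod_val, mul_comm]
  have sq_imp : ∀ {x y : ZMod 61}, x ^ 2 = y ^ 2 → x = y ∨ x = -y := by
    intro x y h
    have h0 : (x - y) * (x + y) = 0 := by linear_combination h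
    rcases mul_eq_zero.1 h0 with h1 | h1
    · left; linear_combination h1
    · right; linear_combination h1
  have cases_of_val : ∀ {x x' : ZMod 61}, x' ≠ 0 → x ≠ 0 →
      ((x'⁻¹ * x).val = 0 ∨ (x'⁻¹ * x).val = 1 ∨ (x'⁻¹ * x).val = 60 ∨ (x'⁻¹ * x).val = 20 ∨ (x'⁻¹ * x).val = 41) →
      (x = x' ∨ x = -x') ∨ x ^ 2 = 34 * x' ^ 2 := by
    intro x x' hx' hx h
    rcases h with h | h | h | h | h
    · exact absurd ((ZMod.val_eq_zero _).1 h) (mul_ne_zero (inv_ne_zero hx') hx)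
    · left; left; have h' := key hx' 1 h; rw [Nat.cast_one, one_mul] at h'; exact h'
    · left; right; have h' := key hx' 60 h; rw [h60] at h'; linear_combination h'
    · right; have h' := key hx' 20 h; rw [h', h20]; linear_combination (6 * x' ^ 2) * h61
    · right; have h' := key hx' 41 h; rw [h', h41]; linear_combination (27 * x' ^ 2) * h61
  have hfe2 : f ^ 2 = e ^ 2 := by
    rcases hfe with h | h
    · rw [h]
    · rw [h]; ring
  simp only [Finset.mem_insert, Finset.mem_singleton] at hr1 hr2
  rcases cases_of_val he' he hr1 with hab | he2
  · exact hAB hab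
  rcases cases_of_val hf' hf hr2 with hff | hf2
  · -- f = ±f′ and f = ±e: e² = f′², so e = ±f′
    have hff2 : f ^ 2 = f' ^ 2 := by
      rcases hff with h | h
      · rw [h]
      · rw [h]; ring
    exact hAC (sq_imp (by rw [← hff2, hfe2]))
  · -- e² = 34e′², f² = 34f′², f² = e²: e′² = f′² (9·34 ≡ 1 mod 61)
    have h34 : (34 : ZMod 61) * e' ^ 2 = 34 * f' ^ 2 := by rw [← he2, ← hf2, hfe2]
    exact hBC (sq_imp (by linear_combination (9 : ZMod 61) * h34 - (5 * (e' ^ 2 - f' ^ 2)) * h61))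

end Summit.MatrixMultiplication.OmegaCensus.CubeNB
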